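import Literature.Probability.Percolation.FiveMarkedLoopLemma
import Literature.Probability.Percolation.TriSiteHalfCounting
import Mathlib.Algebra.Field.ZMod
import Mathlib.LinearAlgebra.Matrix.Rank
import Mathlib.FieldTheory.Finiteness
import HarnessLib

/-!
# The five-marked loop lemma, III: the loop space — injectivity, `2 ^ #G` configurations, surjectivity

Topic `Literature/Probability/Percolation`; proofs (pcv-sawmu b-engine-2 g5), for EVERY `D : TriMarkedDomain 5`, of the
colouring ↔ loop-configuration bijection behind Khristoforov–Smirnov 2021 §1.2 («This map is a bijection», «exactly
2^{#Faces(Ω)} loop configurations with given disorders», p. 4):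
* `loopInj_holds` — two colourings with the same loop configuration agree on `G` (the agreement set contains the base
  site, read off its boundary dart, and is closed under the bonds of the connected graph `G`);
* `loopCount_holds` — `#W_Ω(y_{r+1}, …, y_{r+4}) = 2 ^ #G`: the loop space is an affine coset of the cycle space of the
  graph `H_G` (faces touching `G`, bonds with an endpoint in `G`); over `𝔽₂` its incidence matrix `incMat` has the
  constants as cokernel (`const_of_ker`: `H_G` is connected through the hexagons of the connected `G`), so rank
  `#faces − 1`, and `#bonds + 1 = #faces + #G` (`card_hBonds_add_one`, from the tree's face bookkeeping and `D.euler`)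
  gives dimension `#G` (Mathlib `Matrix.rank_transpose`, rank–nullity, `Module.card_eq_pow_finrank`);
* `loopSurj_holds` — from injectivity, image and the count;
* `card_filter_parity_eq` — more generally EVERY even parity pattern (e.g. the five corner faces + one interior face, the
  six-odd-point space of the five-point normalisation) is attained by exactly `2 ^ #G` edge sets (`mem_range_incMat_iff`:
  the image of the incidence matrix is the hyperplane `Σ_F t F = 0`);
* `khsLemma2Face_holds` — **Khristoforov–Smirnov's Lemma 2 as printed**, per reference corner: the open-crossing
  probability `P_{1/2}[A_{r+1} ↔ A_{r+3}]` equals `#{ξ ∈ W_Ω : pattern B} / #W_Ω` (the counting bridge is the tree's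
  `TriMarkedDomain.openCrossingProb_eq_card_div`, the dictionary `xiPatternB_xiOf_iff` + `fiveMarkedLoopLemma_holds`).

## References
* M. Khristoforov, S. Smirnov, *Percolation and O(1) loop model*, arXiv:2111.15612 (2021), §1.2 (Def. 3, Lemma 2, Lemma 4).
* B. Bollobás, O. Riordan, *Percolation*, Cambridge University Press (2006), Ch. 7 §7.2.2 pp. 168–171 (Lemma 5, Fig. 9).
-/

open Finset

namespace Literature.Probability.Percolation.FivePoint

open Literature.Probability.Percolation Literature.Probability.LatticeModels

variable (D : TriMarkedDomain 5)

/-- Auxiliary. [folklore] -/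
private theorem fin3_cases₄ (v j : Fin 3) : j = v ∨ j = v + 1 ∨ j = v + 2 := by
  revert v j; decide

/-! ### LoopInj: the colouring of `G` is determined by its loop configuration (flood fill from the base site) -/

/-- membership of an `H_G`-bond in `ξ_{r,c}(σ)` = the bond is bicoloured. [cite: KhristoforovSmirnov2021, §1.2 (loop configurations, pp. 3–4)] -/
theorem mem_xiOf_iff' (σ : SiteConfig (Site 2)) (r : Fin 5) (c : Bool) {u v : Site 2} (hadj : triGraph.Adj u v)
    (hG : u ∈ D.verts ∨ v ∈ D.verts) : s(u, v) ∈ xiOf D σ r c ↔ Bicol D σ r c u v := by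
  classical
  unfold xiOf
  rw [Finset.mem_filter]
  constructor
  · rintro ⟨-, a, b, he, hb⟩
    rcases Sym2.eq_iff.1 he with ⟨h1, h2⟩ | ⟨h1, h2⟩
    · rw [h1, h2]; exact hb
    · rw [h1, h2]; exact (bicol_comm D σ r c a b).1 hb
  · intro hb
    exact ⟨mem_hBonds D hadj hG, u, v, rfl, hb⟩

/-- `Bicol` across a bond of `G`: the two states differ. [cite: KhristoforovSmirnov2021, §1.2 (loop configurations, pp. 3–4)] -/
theorem bicol_iff_of_mem_mem (σ : SiteConfig (Site 2)) (r : Fin 5) (c : Bool) {u v : Site 2} (hu : u ∈ D.verts)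
    (hv : v ∈ D.verts) : Bicol D σ r c u v ↔ (u ∈ σ ↔ v ∉ σ) := by
  unfold Bicol
  constructor
  · rintro (⟨-, -, h⟩ | ⟨-, h, -⟩ | ⟨-, h, -⟩)
    · exact h
    · exact absurd hv h
    · exact absurd hu h
  · intro h; exact Or.inl ⟨hu, hv, h⟩

/-- `Bicol` across a boundary dart: the inner state differs from the outer colour. [cite: KhristoforovSmirnov2021, §1.2 (loop configurations, pp. 3–4)] -/
theorem bicol_iff_of_mem_not_mem (σ : SiteConfig (Site 2)) (r : Fin 5) (c : Bool) {u w : Site 2} (hu : u ∈ D.verts)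
    (hw : w ∉ D.verts) : Bicol D σ r c u w ↔ (u ∈ σ ↔ arcColour r c (stretchIdx D (u, w)) = false) := by
  unfold Bicol
  constructor
  · rintro (⟨-, h, -⟩ | ⟨-, -, h⟩ | ⟨h, -, -⟩)
    · exact absurd h hw
    · exact h
    · exact absurd h hw
  · intro h; exact Or.inr (Or.inl ⟨hu, hw, h⟩)

/-- Auxiliary. [folklore] -/
private theorem iff_propagate {a b a' b' : Prop} (h : (a ↔ ¬b) ↔ (a' ↔ ¬b')) : (a ↔ a') ↔ (b ↔ b') := by
  by_cases ha : a <;> by_cases hb : b <;> by_cases ha' : a' <;> by_cases hb' : b' <;> simp_all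

/-- Auxiliary. [folklore] -/
private theorem iff_anchor {a a' k : Prop} (h : (a ↔ k) ↔ (a' ↔ k)) : a ↔ a' := by
  by_cases ha : a <;> by_cases ha' : a' <;> by_cases hk : k <;> simp_all

/-- **LoopInj holds for every domain**: two colourings with the same loop configuration agree on `G` (their agreement
set contains the base site — read off its boundary dart — and is closed under the bonds of the connected graph `G`). [cite: KhristoforovSmirnov2021, §1.2 (loop configurations, pp. 3–4)] -/
theorem loopInj_holds : LoopInj D := by
  intro σ σ' r c hξ
  have hstep : ∀ u v : Site 2, u ∈ D.verts → v ∈ D.verts → triGraph.Adj u v →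
      ((u ∈ σ ↔ u ∈ σ') ↔ (v ∈ σ ↔ v ∈ σ')) := by
    intro u v hu hv hadj
    have h1 := mem_xiOf_iff' D σ r c hadj (Or.inl hu)
    have h2 := mem_xiOf_iff' D σ' r c hadj (Or.inl hu)
    rw [hξ] at h1
    have key := h1.symm.trans h2
    rw [bicol_iff_of_mem_mem D σ r c hu hv, bicol_iff_of_mem_mem D σ' r c hu hv] at key
    exact iff_propagate key
  have hbase : (D.base.1 ∈ σ ↔ D.base.1 ∈ σ') := by
    obtain ⟨hu, hw, hadj⟩ := mem_triBdryDarts.1 D.base_mem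
    have h1 := mem_xiOf_iff' D σ r c hadj (Or.inl hu)
    have h2 := mem_xiOf_iff' D σ' r c hadj (Or.inl hu)
    rw [hξ] at h1
    have key := h1.symm.trans h2
    rw [bicol_iff_of_mem_not_mem D σ r c hu hw, bicol_iff_of_mem_not_mem D σ' r c hu hw] at key
    exact iff_anchor key
  intro u hu
  have hreach := D.connected.preconnected ⟨D.base.1, Finset.mem_coe.2 (mem_triBdryDarts.1 D.base_mem).1⟩ ⟨u, Finset.mem_coe.2 hu⟩
  obtain ⟨p⟩ := hreach
  suffices h : ∀ (a b : ↥((D.verts : Finset (Site 2)) : Set (Site 2))) (q : (triGraph.induce ((D.verts : Finset (Site 2)) : Set (Site 2))).Walk a b),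
      ((a : Site 2) ∈ σ ↔ (a : Site 2) ∈ σ') → ((b : Site 2) ∈ σ ↔ (b : Site 2) ∈ σ') from h _ _ p hbase
  intro a b q
  induction q with
  | nil => exact id
  | @cons u' x' b' hadj q' ih =>
    intro ha
    have hadj' : triGraph.Adj (u' : Site 2) (x' : Site 2) := hadj
    exact ih ((hstep u' x' (Finset.mem_coe.1 u'.2) (Finset.mem_coe.1 x'.2) hadj').1 ha)


/-! ### LoopCount: the loop space is a coset of the cycle space of `H_G` (incidence over `𝔽₂`) -/

section LoopCount

/-! #### Euler bookkeeping: `#hBonds + 1 = #(faces touching G) + #G` -/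

/-- twice the number of `H_G`-bonds = ordered adjacent pairs inside `G` + twice the boundary darts. [cite: KhristoforovSmirnov2021, §1.2 (loop configurations, pp. 3–4)] -/
theorem card_hBonds_two_mul :
    2 * #(hBonds D) = #(triAdjPairs D.verts) + 2 * #(triBdryDarts D.verts) := by
  classical
  set P := ((D.verts ∪ triOuterBdry D.verts) ×ˢ (D.verts ∪ triOuterBdry D.verts)).filter
      fun p : Site 2 × Site 2 => triGraph.Adj p.1 p.2 ∧ (p.1 ∈ D.verts ∨ p.2 ∈ D.verts) with hP
  have hmemP : ∀ p : Site 2 × Site 2, p ∈ P ↔ triGraph.Adj p.1 p.2 ∧ (p.1 ∈ D.verts ∨ p.2 ∈ D.verts) := by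
    intro p
    rw [hP, Finset.mem_filter, Finset.mem_product]
    constructor
    · exact fun h => h.2
    · rintro ⟨hadj, hG⟩
      have key : ∀ a b : Site 2, triGraph.Adj a b → (a ∈ D.verts ∨ b ∈ D.verts) → a ∈ D.verts ∪ triOuterBdry D.verts := by
        intro a b hab h
        by_cases ha : a ∈ D.verts
        · exact Finset.mem_union_left _ ha
        · exact Finset.mem_union_right _ (Finset.mem_image.2 ⟨(b, a), mem_triBdryDarts.2 ⟨h.resolve_left ha, ha, hab.symm⟩, rfl⟩)
      exact ⟨⟨key _ _ hadj hG, key _ _ hadj.symm hG.symm⟩, hadj, hG⟩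
  have hPdef : hBonds D = P.image fun p => s(p.1, p.2) := rfl
  -- each bond has exactly the two preimages (u, v), (v, u)
  have hfib : ∀ b ∈ hBonds D, #(P.filter fun p => s(p.1, p.2) = b) = 2 := by
    intro b hb
    rw [hPdef] at hb
    obtain ⟨p, hp, rfl⟩ := Finset.mem_image.1 hb
    have hp' := (hmemP p).1 hp
    have hne : p.1 ≠ p.2 := hp'.1.ne
    have : P.filter (fun q => s(q.1, q.2) = s(p.1, p.2)) = {p, (p.2, p.1)} := by
      ext q
      rw [Finset.mem_filter, Finset.mem_insert, Finset.mem_singleton, hmemP]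
      constructor
      · rintro ⟨-, he⟩
        rcases Sym2.eq_iff.1 he with ⟨h1, h2⟩ | ⟨h1, h2⟩
        · exact Or.inl (Prod.ext h1 h2)
        · exact Or.inr (Prod.ext h1 h2)
      · rintro (rfl | rfl)
        · exact ⟨hp', rfl⟩
        · exact ⟨⟨hp'.1.symm, hp'.2.symm⟩, Sym2.eq_swap⟩
    rw [this]
    exact Finset.card_pair fun he => hne (congrArg Prod.fst he)
  have hcardP : #P = 2 * #(hBonds D) := by
    have := Finset.card_eq_sum_card_fiberwise (f := fun p : Site 2 × Site 2 => s(p.1, p.2)) (s := P) (t := hBonds D)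
      (fun p hp => by rw [hPdef]; exact Finset.mem_image_of_mem _ hp)
    rw [this, Finset.sum_congr rfl hfib, Finset.sum_const, smul_eq_mul, mul_comm]
  have hsplit : #P = #(triAdjPairs D.verts) + 2 * #(triBdryDarts D.verts) := by
    have hdisj : P = triAdjPairs D.verts ∪ (triBdryDarts D.verts ∪ (triBdryDarts D.verts).image Prod.swap) := by
      ext p
      rw [hmemP, Finset.mem_union, Finset.mem_union, mem_triAdjPairs, mem_triBdryDarts, Finset.mem_image]
      constructor
      · rintro ⟨hadj, hG⟩
        by_cases h1 : p.1 ∈ D.verts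
        · by_cases h2 : p.2 ∈ D.verts
          · exact Or.inl ⟨h1, h2, hadj⟩
          · exact Or.inr (Or.inl ⟨h1, h2, hadj⟩)
        · have h2 : p.2 ∈ D.verts := hG.resolve_left h1
          exact Or.inr (Or.inr ⟨(p.2, p.1), mem_triBdryDarts.2 ⟨h2, h1, hadj.symm⟩, rfl⟩)
      · rintro (⟨h1, -, hadj⟩ | ⟨h1, -, hadj⟩ | ⟨q, hq, rfl⟩)
        · exact ⟨hadj, Or.inl h1⟩
        · exact ⟨hadj, Or.inl h1⟩
        · obtain ⟨hq1, -, hq⟩ := mem_triBdryDarts.1 hq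
          exact ⟨hq.symm, Or.inr hq1⟩
    rw [hdisj, Finset.card_union_of_disjoint, Finset.card_union_of_disjoint,
      Finset.card_image_of_injective _ Prod.swap_injective]
    · ring
    · rw [Finset.disjoint_left]
      intro p hp hp'
      obtain ⟨q, hq, rfl⟩ := Finset.mem_image.1 hp'
      exact (mem_triBdryDarts.1 hq).2.1 (mem_triBdryDarts.1 hp).1
    · rw [Finset.disjoint_left]
      intro p hp hp'
      rcases Finset.mem_union.1 hp' with h | h
      · exact (mem_triBdryDarts.1 h).2.1 (mem_triAdjPairs.1 hp).2.1
      · obtain ⟨q, hq, rfl⟩ := Finset.mem_image.1 h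
        exact (mem_triBdryDarts.1 hq).2.1 (mem_triAdjPairs.1 hp).1
  omega


/-- the faces touching `G` are the faces inside `G` plus the boundary faces (one per boundary dart). [cite: KhristoforovSmirnov2021, §1.2 (loop configurations, pp. 3–4)] -/
theorem card_triFacesIn_add_card_triBdryDarts :
    #(triFacesIn D.verts) + #(triBdryDarts D.verts) = #(triFacesTouching D.verts) := by
  classical
  have hT1 := card_filter_turnDeg_eq D.verts (c := 1) (Or.inl rfl)
  have hT2 := card_filter_turnDeg_eq D.verts (c := 2) (Or.inr rfl)
  have hL : #(triBdryDarts D.verts) = #((triBdryDarts D.verts).filter fun d => turnDeg D.verts d = 1) +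
      #((triBdryDarts D.verts).filter fun d => turnDeg D.verts d = 2) := by
    rw [Finset.card_filter, Finset.card_filter, ← Finset.sum_add_distrib, Finset.card_eq_sum_ones]
    refine Finset.sum_congr rfl fun d _ => ?_
    unfold turnDeg
    split_ifs <;> simp_all
  have hF : #(triFacesIn D.verts) = #((triFacesTouching D.verts).filter fun w => faceDeg D.verts w = 3) := by
    rw [card_triFacesIn_eq_sum, Finset.card_filter]
  rw [hL, hT1, hT2, hF, Finset.card_filter, Finset.card_filter, Finset.card_filter, ← Finset.sum_add_distrib,
    ← Finset.sum_add_distrib, Finset.card_eq_sum_ones]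
  refine Finset.sum_congr rfl fun w hw => ?_
  have hle := faceDeg_le D.verts w
  have hge := one_le_faceDeg hw
  interval_cases (faceDeg D.verts w) <;> simp

/-- **Euler bookkeeping for `H_G`**: `#E(H_G) + 1 = #V(H_G) + #G` (the union of hexagons is a disc: `D.euler`). [cite: KhristoforovSmirnov2021, §1.2 (loop configurations, pp. 3–4)] -/
theorem card_hBonds_add_one : #(hBonds D) + 1 = #(triFacesTouching D.verts) + #D.verts := by
  have h2 := card_hBonds_two_mul D
  have hE := D.euler
  unfold triEulerTwice at hE
  have hT := card_triFacesIn_add_card_triBdryDarts D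
  omega


/-! #### Incidence in `H_G`: bonds and their two bordering faces, faces and their three sides -/

/-- a bond is INCIDENT to a face when both its endpoints are vertices of the face. [cite: KhristoforovSmirnov2021, §1.2 (loop configurations, pp. 3–4)] -/
def Inc (F : HexVertex) (b : Sym2 (Site 2)) : Prop := ∀ x ∈ b, x ∈ hexFaceVertices F

/-- Auxiliary. [cite: KhristoforovSmirnov2021, §1.2 (loop configurations, pp. 3–4)] -/
theorem inc_mk_iff {F : HexVertex} {u v : Site 2} : Inc F s(u, v) ↔ u ∈ hexFaceVertices F ∧ v ∈ hexFaceVertices F := by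
  unfold Inc
  constructor
  · intro h; exact ⟨h u (Sym2.mem_mk_left u v), h v (Sym2.mem_mk_right u v)⟩
  · rintro ⟨hu, hv⟩ x hx
    rcases Sym2.mem_iff.1 hx with rfl | rfl
    · exact hu
    · exact hv

/-- the `j`-th side of a face. [folklore] -/
def side (F : HexVertex) (j : Fin 3) : Sym2 (Site 2) := s(faceVertex F (j + 1), faceVertex F (j + 2))

/-- a face is incident to its sides. [cite: KhristoforovSmirnov2021, §1.2 (loop configurations, pp. 3–4)] -/
theorem inc_side (F : HexVertex) (j : Fin 3) : Inc F (side F j) :=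
  inc_mk_iff.2 ⟨faceVertex_mem _ _, faceVertex_mem _ _⟩

/-- the three sides of a face are distinct bonds. [cite: KhristoforovSmirnov2021, §1.2 (loop configurations, pp. 3–4)] -/
theorem side_injective (F : HexVertex) : Function.Injective (side F) := by
  intro j k h
  unfold side at h
  rcases Sym2.eq_iff.1 h with ⟨h1, -⟩ | ⟨h1, h2⟩
  · exact add_right_cancel (faceVertex_injective F h1)
  · have e1 := faceVertex_injective F h1
    have e2 := faceVertex_injective F h2
    -- `j + 1 = k + 2` and `j + 2 = k + 1` is impossible in `Fin 3`
    exact absurd e2 ((by decide : ∀ j k : Fin 3, j + 1 = k + 2 → j + 2 ≠ k + 1) j k e1)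

/-- an `H_G`-bond incident to a face is one of its sides. [cite: KhristoforovSmirnov2021, §1.2 (loop configurations, pp. 3–4)] -/
theorem exists_side_eq_of_inc {F : HexVertex} {b : Sym2 (Site 2)} (hb : b ∈ hBonds D) (h : Inc F b) :
    ∃ j : Fin 3, b = side F j := by
  classical
  obtain ⟨p, hp, rfl⟩ := Finset.mem_image.1 hb
  have hadj : triGraph.Adj p.1 p.2 := (Finset.mem_filter.1 hp).2.1
  obtain ⟨h1, h2⟩ := inc_mk_iff.1 h
  obtain ⟨a, ha⟩ := mem_hexFaceVertices_iff_faceVertex.1 h1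
  obtain ⟨c, hc⟩ := mem_hexFaceVertices_iff_faceVertex.1 h2
  have hac : c ≠ a := fun e => hadj.ne (by rw [ha, hc, e])
  have e3 : a + 2 + 1 = a := by rw [add_assoc]; exact add_eq_left.2 (by decide)
  have e4 : a + 2 + 2 = a + 1 := by rw [add_assoc]; congr 1
  have e5 : a + 1 + 1 = a + 2 := by rw [add_assoc]; rfl
  have e6 : a + 1 + 2 = a := by rw [add_assoc]; exact add_eq_left.2 (by decide)
  unfold side
  rcases fin3_cases₄ a c with e | e | e
  · exact absurd e hac
  · refine ⟨a + 2, ?_⟩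
    rw [e3, e4, ← e, ← ha, ← hc]
  · refine ⟨a + 1, ?_⟩
    rw [e5, e6, ← e, ← ha, ← hc, Sym2.eq_swap]

open Classical in
/-- the faces touching `G` incident to an `H_G`-bond are its two bordering faces. [cite: KhristoforovSmirnov2021, §1.2 (loop configurations, pp. 3–4)] -/
theorem filter_inc_eq_pair {u v : Site 2} (hu : u ∈ D.verts) (hadj : triGraph.Adj u v) :
    (triFacesTouching D.verts).filter (fun F => Inc F s(u, v)) = {leftFace u v, leftFace v u} := by
  classical
  rw [← filter_mem_mem_eq_pair hu hadj]
  exact Finset.filter_congr fun F _ => inc_mk_iff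

/-- every `H_G`-bond is `s(u, v)` with `u ∈ G` and `u ∼ v`. [cite: KhristoforovSmirnov2021, §1.2 (loop configurations, pp. 3–4)] -/
theorem exists_rep_of_mem_hBonds {b : Sym2 (Site 2)} (hb : b ∈ hBonds D) :
    ∃ u v : Site 2, b = s(u, v) ∧ u ∈ D.verts ∧ triGraph.Adj u v := by
  classical
  obtain ⟨p, hp, rfl⟩ := Finset.mem_image.1 hb
  obtain ⟨-, hadj, hG⟩ := Finset.mem_filter.1 hp
  rcases hG with h | h
  · exact ⟨p.1, p.2, rfl, h, hadj⟩
  · exact ⟨p.2, p.1, Sym2.eq_swap, h, hadj.symm⟩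

/-! #### The incidence matrix over `𝔽₂`; indicators; the boundary of an indicator is the side count -/

open Classical in
/-- the incidence matrix of `H_G` over `𝔽₂`: rows = faces touching `G`, columns = `H_G`-bonds. [folklore] -/
noncomputable def incMat : Matrix ↥(triFacesTouching D.verts) ↥(hBonds D) (ZMod 2) :=
  fun F b => if Inc F.1 b.1 then 1 else 0

open Classical in
/-- the indicator vector of an edge set on the `H_G`-bonds. [folklore] -/
noncomputable def indic (ξ : Finset (Sym2 (Site 2))) : ↥(hBonds D) → ZMod 2 := fun b => if b.1 ∈ ξ then 1 else 0

/-- **the boundary of an indicator counts sides**: `(M · 𝟙_ξ)(F) = xiDeg ξ F (mod 2)` for `ξ ⊆ hBonds`. [cite: KhristoforovSmirnov2021, §1.2 (loop configurations, pp. 3–4)] -/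
theorem incMat_mulVec_indic {ξ : Finset (Sym2 (Site 2))} (hξ : ξ ⊆ hBonds D) (F : ↥(triFacesTouching D.verts)) :
    (incMat D).mulVec (indic D ξ) F = (xiDeg ξ F.1 : ZMod 2) := by
  classical
  have hterm : ∀ b : ↥(hBonds D), incMat D F b * indic D ξ b = if (Inc F.1 b.1 ∧ b.1 ∈ ξ) then (1 : ZMod 2) else 0 := by
    intro b
    unfold incMat indic
    by_cases h1 : Inc F.1 b.1 <;> by_cases h2 : b.1 ∈ ξ <;> simp [h1, h2]
  have hsum : (incMat D).mulVec (indic D ξ) F = ∑ b, incMat D F b * indic D ξ b := rfl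
  rw [hsum, Finset.sum_congr rfl (fun b _ => hterm b), Finset.sum_boole]
  unfold xiDeg
  congr 1
  -- bijection `j ↦ side F j` between `{j | side j ∈ ξ}` and `{b ∈ hBonds | Inc F b ∧ b ∈ ξ}`
  symm
  refine Finset.card_bij (fun j hj => (⟨side F.1 j, hξ (Finset.mem_filter.1 hj).2⟩ : ↥(hBonds D)))
    (fun j hj => ?_) (fun j₁ _ j₂ _ h => side_injective F.1 (congrArg Subtype.val h)) (fun b hb => ?_)
  · exact Finset.mem_filter.2 ⟨Finset.mem_univ _, inc_side F.1 j, (Finset.mem_filter.1 hj).2⟩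
  · obtain ⟨-, hinc, hmem⟩ := Finset.mem_filter.1 hb
    obtain ⟨j, hj⟩ := exists_side_eq_of_inc D b.2 hinc
    refine ⟨j, Finset.mem_filter.2 ⟨Finset.mem_univ _, ?_⟩, Subtype.ext hj.symm⟩
    show side F.1 j ∈ ξ
    rw [← hj]; exact hmem


/-! #### The coboundary `Mᵀ` has the constants as kernel (`H_G` is connected) -/

/-- the left face of a bond with tail in `G` touches `G`. [cite: KhristoforovSmirnov2021, §1.2 (loop configurations, pp. 3–4)] -/
theorem leftFace_mem_touching {u v : Site 2} (hu : u ∈ D.verts) (hadj : triGraph.Adj u v) :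
    leftFace u v ∈ triFacesTouching D.verts :=
  mem_triFacesTouching.2 ⟨u, hu, by rw [hexFaceVertices_leftFace hadj]; simp⟩

/-- the right face of a bond with tail in `G` touches `G`. [cite: KhristoforovSmirnov2021, §1.2 (loop configurations, pp. 3–4)] -/
theorem leftFace_symm_mem_touching {u v : Site 2} (hu : u ∈ D.verts) (hadj : triGraph.Adj u v) :
    leftFace v u ∈ triFacesTouching D.verts :=
  mem_triFacesTouching.2 ⟨u, hu, by rw [hexFaceVertices_leftFace hadj.symm]; simp⟩

/-- the value of a face function extended by `0` off the faces touching `G`. [folklore] -/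
noncomputable def fval (f : ↥(triFacesTouching D.verts) → ZMod 2) (F : HexVertex) : ZMod 2 := by
  classical
  exact if h : F ∈ triFacesTouching D.verts then f ⟨F, h⟩ else 0

/-- Auxiliary. [cite: KhristoforovSmirnov2021, §1.2 (loop configurations, pp. 3–4)] -/
theorem fval_of_mem (f : ↥(triFacesTouching D.verts) → ZMod 2) {F : HexVertex} (h : F ∈ triFacesTouching D.verts) :
    fval D f F = f ⟨F, h⟩ := by
  unfold fval; rw [dif_pos h]

/-- **the coboundary at a bond**: `(Mᵀ f)(uv) = f(left face) + f(right face)`. [cite: KhristoforovSmirnov2021, §1.2 (loop configurations, pp. 3–4)] -/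
theorem incMat_transpose_mulVec_apply (f : ↥(triFacesTouching D.verts) → ZMod 2) {u v : Site 2} (hu : u ∈ D.verts)
    (hadj : triGraph.Adj u v) (hb : s(u, v) ∈ hBonds D) :
    (incMat D).transpose.mulVec f ⟨s(u, v), hb⟩ = fval D f (leftFace u v) + fval D f (leftFace v u) := by
  classical
  have hsum : (incMat D).transpose.mulVec f ⟨s(u, v), hb⟩ = ∑ F, (if Inc F.1 s(u, v) then (1 : ZMod 2) else 0) * f F := rfl
  rw [hsum]
  simp only [boole_mul]
  rw [← Finset.sum_filter]
  have hpair : (Finset.univ.filter fun F : ↥(triFacesTouching D.verts) => Inc F.1 s(u, v)) =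
      {⟨leftFace u v, leftFace_mem_touching D hu hadj⟩, ⟨leftFace v u, leftFace_symm_mem_touching D hu hadj⟩} := by
    ext F
    rw [Finset.mem_filter, Finset.mem_insert, Finset.mem_singleton]
    have key : Inc F.1 s(u, v) ↔ F.1 = leftFace u v ∨ F.1 = leftFace v u := by
      have := Finset.ext_iff.1 (filter_inc_eq_pair D hu hadj) F.1
      rw [Finset.mem_filter, Finset.mem_insert, Finset.mem_singleton] at this
      exact ⟨fun h => this.1 ⟨F.2, h⟩, fun h => (this.2 h).2⟩
    simp only [Finset.mem_univ, true_and, key, Subtype.ext_iff]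
  rw [hpair, Finset.sum_pair, fval_of_mem, fval_of_mem]
  intro he
  exact leftFace_ne_leftFace_symm hadj (congrArg Subtype.val he)

/-- in `ZMod 2`, `a + b = 0 ↔ a = b`. [folklore] -/
private theorem zmod2_add_eq_zero_iff (a b : ZMod 2) : a + b = 0 ↔ a = b := by
  revert a b; decide

/-- a function in the kernel of the coboundary takes equal values on the two faces of every `H_G`-bond. [cite: KhristoforovSmirnov2021, §1.2 (loop configurations, pp. 3–4)] -/
theorem fval_leftFace_eq_of_ker {f : ↥(triFacesTouching D.verts) → ZMod 2} (hf : (incMat D).transpose.mulVec f = 0)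
    {u v : Site 2} (hu : u ∈ D.verts) (hadj : triGraph.Adj u v) :
    fval D f (leftFace u v) = fval D f (leftFace v u) := by
  have hb : s(u, v) ∈ hBonds D := mem_hBonds D hadj (Or.inl hu)
  have := congrFun hf ⟨s(u, v), hb⟩
  rw [incMat_transpose_mulVec_apply D f hu hadj hb] at this
  exact (zmod2_add_eq_zero_iff _ _).1 this

/-- a kernel function is constant around every site of `G`. [cite: KhristoforovSmirnov2021, §1.2 (loop configurations, pp. 3–4)] -/
theorem fval_leftFaceDir_eq_of_ker {f : ↥(triFacesTouching D.verts) → ZMod 2} (hf : (incMat D).transpose.mulVec f = 0)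
    {u : Site 2} (hu : u ∈ D.verts) (k : Fin 6) : fval D f (leftFaceDir u k) = fval D f (leftFaceDir u 0) := by
  have hstep : ∀ k : Fin 6, fval D f (leftFaceDir u k) = fval D f (leftFaceDir u (k + 5)) := by
    intro k
    rw [← leftFace_add_triDir u k, ← leftFace_add_triDir_rev u k]
    exact fval_leftFace_eq_of_ker D hf hu (triGraph_adj_add_triDir u k)
  have h1 := hstep 1; have h2 := hstep 2; have h3 := hstep 3; have h4 := hstep 4; have h5 := hstep 5
  fin_cases k
  · rfl
  · exact h1
  · exact h2.trans h1
  · exact h3.trans (h2.trans h1)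
  · exact h4.trans (h3.trans (h2.trans h1))
  · exact h5.trans (h4.trans (h3.trans (h2.trans h1)))

/-- a kernel function takes the same reference value at adjacent sites of `G`. [cite: KhristoforovSmirnov2021, §1.2 (loop configurations, pp. 3–4)] -/
theorem fval_base_eq_of_adj_of_ker {f : ↥(triFacesTouching D.verts) → ZMod 2} (hf : (incMat D).transpose.mulVec f = 0)
    {u v : Site 2} (hu : u ∈ D.verts) (hv : v ∈ D.verts) (hadj : triGraph.Adj u v) :
    fval D f (leftFaceDir u 0) = fval D f (leftFaceDir v 0) := by
  -- the face left of `u → v` lies at `u` and at `v`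
  obtain ⟨k, rfl⟩ := (triGraph_adj_iff_triDir u v).1 hadj
  have hF : leftFaceDir u k ∈ facesAt (u + triDir k) := by
    rw [mem_facesAt, RemovableAt.hexFaceVertices_leftFaceDir]; simp
  rw [facesAt_eq_image_leftFaceDir] at hF
  obtain ⟨k', -, hk'⟩ := Finset.mem_image.1 hF
  rw [← fval_leftFaceDir_eq_of_ker D hf hu k, ← fval_leftFaceDir_eq_of_ker D hf hv k', hk']

/-- **the kernel of the coboundary consists of constant functions** (`G` connected, every face touching `G` at a
site of `G`). [cite: KhristoforovSmirnov2021, §1.2 (loop configurations, pp. 3–4)] -/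
theorem const_of_ker {f : ↥(triFacesTouching D.verts) → ZMod 2} (hf : (incMat D).transpose.mulVec f = 0)
    (F F' : ↥(triFacesTouching D.verts)) : f F = f F' := by
  -- reference values agree along `G`
  have hG : ∀ u, u ∈ D.verts → fval D f (leftFaceDir u 0) = fval D f (leftFaceDir D.base.1 0) := by
    intro u hu
    have hb : D.base.1 ∈ D.verts := (mem_triBdryDarts.1 D.base_mem).1
    obtain ⟨p⟩ := D.connected.preconnected ⟨D.base.1, Finset.mem_coe.2 hb⟩ ⟨u, Finset.mem_coe.2 hu⟩
    suffices h : ∀ (a b : ↥((D.verts : Finset (Site 2)) : Set (Site 2)))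
        (q : (triGraph.induce ((D.verts : Finset (Site 2)) : Set (Site 2))).Walk a b),
        fval D f (leftFaceDir (a : Site 2) 0) = fval D f (leftFaceDir (b : Site 2) 0) from (h _ _ p).symm
    intro a b q
    induction q with
    | nil => rfl
    | @cons u' x' b' hadj q' ih =>
      have hadj' : triGraph.Adj (u' : Site 2) (x' : Site 2) := hadj
      exact (fval_base_eq_of_adj_of_ker D hf (Finset.mem_coe.1 u'.2) (Finset.mem_coe.1 x'.2) hadj').trans ih
  -- every face touching `G` is a face at a site of `G`
  have hF : ∀ F : ↥(triFacesTouching D.verts), f F = fval D f (leftFaceDir D.base.1 0) := by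
    intro F
    obtain ⟨u, hu, huF⟩ := mem_triFacesTouching.1 F.2
    have hmem : F.1 ∈ facesAt u := mem_facesAt.2 huF
    rw [facesAt_eq_image_leftFaceDir] at hmem
    obtain ⟨k, -, hk⟩ := Finset.mem_image.1 hmem
    rw [← hG u hu, ← fval_leftFaceDir_eq_of_ker D hf hu k, hk, fval_of_mem D f F.2]
  rw [hF F, hF F']


/-! #### Dimension count over `𝔽₂`: the cycle space of `H_G` has `2 ^ #G` elements -/

/-- the faces touching `G` are nonempty. [cite: KhristoforovSmirnov2021, §1.2 (loop configurations, pp. 3–4)] -/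
theorem touching_nonempty : (triFacesTouching D.verts).Nonempty :=
  ⟨_, leftFace_mem_touching D (mem_triBdryDarts.1 D.base_mem).1 (mem_triBdryDarts.1 D.base_mem).2.2⟩

/-- the constant function `1` is a cocycle: every bond has two faces. [cite: KhristoforovSmirnov2021, §1.2 (loop configurations, pp. 3–4)] -/
theorem transpose_mulVec_const_one : (incMat D).transpose.mulVec (fun _ => (1 : ZMod 2)) = 0 := by
  funext b
  obtain ⟨u, v, hb', hu, hadj⟩ := exists_rep_of_mem_hBonds D b.2
  have hb'' : s(u, v) ∈ hBonds D := hb' ▸ b.2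
  have : b = ⟨s(u, v), hb''⟩ := Subtype.ext hb'
  rw [this, incMat_transpose_mulVec_apply D _ hu hadj hb'', fval_of_mem D _ (leftFace_mem_touching D hu hadj),
    fval_of_mem D _ (leftFace_symm_mem_touching D hu hadj), Pi.zero_apply]
  decide

/-- **the kernel of the coboundary is the line of constants.** [cite: KhristoforovSmirnov2021, §1.2 (loop configurations, pp. 3–4)] -/
theorem ker_transpose_eq_span :
    LinearMap.ker (incMat D).transpose.mulVecLin = Submodule.span (ZMod 2) {fun _ => (1 : ZMod 2)} := by
  obtain ⟨F₀, hF₀⟩ := touching_nonempty D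
  ext f
  rw [LinearMap.mem_ker, Matrix.mulVecLin_apply, Submodule.mem_span_singleton]
  constructor
  · intro hf
    refine ⟨f ⟨F₀, hF₀⟩, ?_⟩
    funext F
    rw [Pi.smul_apply, smul_eq_mul, mul_one]
    exact (const_of_ker D hf F ⟨F₀, hF₀⟩).symm
  · rintro ⟨a, rfl⟩
    rw [Matrix.mulVec_smul, transpose_mulVec_const_one, smul_zero]

/-- `finrank (ker Mᵀ) = 1`. [cite: KhristoforovSmirnov2021, §1.2 (loop configurations, pp. 3–4)] -/
theorem finrank_ker_transpose : Module.finrank (ZMod 2) ↥(LinearMap.ker (incMat D).transpose.mulVecLin) = 1 := by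
  obtain ⟨F₀, hF₀⟩ := touching_nonempty D
  rw [ker_transpose_eq_span]
  refine finrank_span_singleton ?_
  intro h
  have := congrFun h ⟨F₀, hF₀⟩
  rw [Pi.zero_apply] at this
  exact one_ne_zero this

/-- **the rank of the incidence matrix is `#faces − 1`.** [cite: KhristoforovSmirnov2021, §1.2 (loop configurations, pp. 3–4)] -/
theorem rank_incMat_add_one : (incMat D).rank + 1 = #(triFacesTouching D.verts) := by
  classical
  have h := LinearMap.finrank_range_add_finrank_ker (incMat D).transpose.mulVecLin
  rw [finrank_ker_transpose, Module.finrank_fintype_fun_eq_card, Fintype.card_coe] at h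
  rw [← Matrix.rank_transpose]
  exact h

/-- **the cycle space of `H_G` has dimension `#G`** (`#E − (#V − 1)` with the Euler count). [cite: KhristoforovSmirnov2021, §1.2 (loop configurations, pp. 3–4)] -/
theorem finrank_ker_incMat : Module.finrank (ZMod 2) ↥(LinearMap.ker (incMat D).mulVecLin) = #D.verts := by
  classical
  have h := LinearMap.finrank_range_add_finrank_ker (incMat D).mulVecLin
  rw [Module.finrank_fintype_fun_eq_card, Fintype.card_coe] at h
  have hr : Module.finrank (ZMod 2) ↥(LinearMap.range (incMat D).mulVecLin) = (incMat D).rank := rfl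
  rw [hr] at h
  have h1 := rank_incMat_add_one D
  have h2 := card_hBonds_add_one D
  omega

/-- hence it has `2 ^ #G` elements. [cite: KhristoforovSmirnov2021, §1.2 (loop configurations, pp. 3–4)] -/
theorem card_ker_incMat : Nat.card ↥(LinearMap.ker (incMat D).mulVecLin) = 2 ^ #D.verts := by
  classical
  rw [Nat.card_eq_fintype_card, Module.card_eq_pow_finrank (K := ZMod 2) (V := ↥(LinearMap.ker (incMat D).mulVecLin)),
    ZMod.card, finrank_ker_incMat]

/-! #### The loop space as an affine coset; LoopCount and LoopSurj -/

open Classical in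
/-- the prescribed boundary: `1` at the corner faces of the marks `j ≠ r`, `0` elsewhere. [folklore] -/
noncomputable def target (r : Fin 5) : ↥(triFacesTouching D.verts) → ZMod 2 :=
  fun F => if (∃ j : Fin 5, j ≠ r ∧ IsCornerFace D j F.1) then 1 else 0

/-- Auxiliary. [folklore] -/
private theorem natCast_eq_ite_iff (n : ℕ) (c : Prop) [Decidable c] :
    (n : ZMod 2) = (if c then 1 else 0) ↔ (Odd n ↔ c) := by
  by_cases hc : c
  · rw [if_pos hc, ZMod.natCast_eq_one_iff_odd]; exact (iff_true_right hc).symm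
  · rw [if_neg hc, ZMod.natCast_eq_zero_iff_even, ← Nat.not_odd_iff_even]; exact (iff_false_right hc).symm

/-- **membership in the loop space = the linear equation `M · 𝟙_ξ = target`.** [cite: KhristoforovSmirnov2021, §1.2 (loop configurations, pp. 3–4)] -/
theorem mem_loopSpace_iff_mulVec (r : Fin 5) (ξ : Finset (Sym2 (Site 2))) :
    ξ ∈ loopSpace D r ↔ ξ ⊆ hBonds D ∧ (incMat D).mulVec (indic D ξ) = target D r := by
  classical
  unfold loopSpace
  rw [Finset.mem_filter, Finset.mem_powerset]
  refine and_congr_right fun hξ => ?_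
  constructor
  · intro h
    funext F
    rw [incMat_mulVec_indic D hξ F]
    unfold target
    exact (natCast_eq_ite_iff _ _).2 (h F.1 F.2)
  · intro h F hF
    have := congrFun h ⟨F, hF⟩
    rw [incMat_mulVec_indic D hξ ⟨F, hF⟩] at this
    unfold target at this
    exact (natCast_eq_ite_iff _ _).1 this

/-- the indicator determines the edge set (inside `hBonds`). [cite: KhristoforovSmirnov2021, §1.2 (loop configurations, pp. 3–4)] -/
theorem indic_injective {ξ ξ' : Finset (Sym2 (Site 2))} (hξ : ξ ⊆ hBonds D) (hξ' : ξ' ⊆ hBonds D)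
    (h : indic D ξ = indic D ξ') : ξ = ξ' := by
  classical
  ext b
  constructor
  · intro hb
    have := congrFun h ⟨b, hξ hb⟩
    unfold indic at this
    rw [if_pos hb] at this
    by_contra hb'
    rw [if_neg hb'] at this
    exact absurd this (by decide)
  · intro hb
    have := congrFun h ⟨b, hξ' hb⟩
    unfold indic at this
    rw [if_pos hb] at this
    by_contra hb'
    rw [if_neg hb'] at this
    exact absurd this (by decide)

/-- every `𝔽₂`-vector on the bonds is the indicator of its support. [cite: KhristoforovSmirnov2021, §1.2 (loop configurations, pp. 3–4)] -/
theorem exists_indic_eq (g : ↥(hBonds D) → ZMod 2) : ∃ ξ : Finset (Sym2 (Site 2)), ξ ⊆ hBonds D ∧ indic D ξ = g := by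
  classical
  refine ⟨((hBonds D).attach.filter fun b => g b = 1).map ⟨Subtype.val, Subtype.val_injective⟩, ?_, ?_⟩
  · intro b hb
    rw [Finset.mem_map] at hb
    obtain ⟨b', -, rfl⟩ := hb
    exact b'.2
  · funext b
    unfold indic
    have hmem : b.1 ∈ ((hBonds D).attach.filter fun b => g b = 1).map ⟨Subtype.val, Subtype.val_injective⟩ ↔ g b = 1 := by
      rw [Finset.mem_map]
      constructor
      · rintro ⟨b', hb', he⟩
        have : b' = b := Subtype.ext he
        subst this
        exact (Finset.mem_filter.1 hb').2
      · intro hg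
        exact ⟨b, Finset.mem_filter.2 ⟨Finset.mem_attach _ _, hg⟩, rfl⟩
    by_cases hg : g b = 1
    · rw [if_pos (hmem.2 hg), hg]
    · rw [if_neg (fun h => hg (hmem.1 h))]
      have : ∀ x : ZMod 2, x ≠ 1 → 0 = x := by decide
      exact this _ hg

/-- **LoopCount holds for every domain**: `#W_Ω(y_{r+1}, …, y_{r+4}) = 2 ^ #G`. [cite: KhristoforovSmirnov2021, §1.2 (loop configurations, pp. 3–4)] -/
theorem loopCount_holds : LoopCount D := by
  classical
  intro r
  -- a particular solution, from the empty colouring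
  set g₀ := indic D (xiOf D ∅ r false) with hg₀
  have hg₀sol : (incMat D).mulVec g₀ = target D r :=
    ((mem_loopSpace_iff_mulVec D r _).1 (loopImage_holds D ∅ r false)).2
  -- loopSpace ≃ solutions of `M g = target`
  have h1 : #(loopSpace D r) = #(Finset.univ.filter fun g : ↥(hBonds D) → ZMod 2 => (incMat D).mulVec g = target D r) := by
    refine Finset.card_bij (fun ξ _ => indic D ξ) (fun ξ hξ => ?_) (fun ξ hξ ξ' hξ' h => ?_) (fun g hg => ?_)
    · exact Finset.mem_filter.2 ⟨Finset.mem_univ _, ((mem_loopSpace_iff_mulVec D r ξ).1 hξ).2⟩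
    · exact indic_injective D ((mem_loopSpace_iff_mulVec D r ξ).1 hξ).1 ((mem_loopSpace_iff_mulVec D r ξ').1 hξ').1 h
    · obtain ⟨ξ, hξ, rfl⟩ := exists_indic_eq D g
      exact ⟨ξ, (mem_loopSpace_iff_mulVec D r ξ).2 ⟨hξ, (Finset.mem_filter.1 hg).2⟩, rfl⟩
  -- solutions ≃ kernel, by translation
  have hself : ∀ g : ↥(hBonds D) → ZMod 2, g + g = 0 := by
    intro g; funext b; exact (zmod2_add_eq_zero_iff _ _).2 rfl
  have h2 : #(Finset.univ.filter fun g : ↥(hBonds D) → ZMod 2 => (incMat D).mulVec g = target D r) =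
      #(Finset.univ.filter fun g : ↥(hBonds D) → ZMod 2 => (incMat D).mulVec g = 0) := by
    refine Finset.card_bij (fun g _ => g + g₀) (fun g hg => ?_) (fun g _ g' _ h => add_right_cancel h) (fun h hh => ?_)
    · refine Finset.mem_filter.2 ⟨Finset.mem_univ _, ?_⟩
      rw [Matrix.mulVec_add, (Finset.mem_filter.1 hg).2, hg₀sol]
      funext F; exact (zmod2_add_eq_zero_iff _ _).2 rfl
    · refine ⟨h + g₀, Finset.mem_filter.2 ⟨Finset.mem_univ _, ?_⟩, ?_⟩
      · rw [Matrix.mulVec_add, (Finset.mem_filter.1 hh).2, hg₀sol, zero_add]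
      · rw [add_assoc, hself, add_zero]
  -- kernel count
  have h3 : #(Finset.univ.filter fun g : ↥(hBonds D) → ZMod 2 => (incMat D).mulVec g = 0) = 2 ^ #D.verts := by
    rw [← card_ker_incMat D, Nat.card_eq_fintype_card, Fintype.card_subtype]
    congr 1
    ext g
    simp only [Finset.mem_filter, Finset.mem_univ, true_and, LinearMap.mem_ker, Matrix.mulVecLin_apply]
  rw [h1, h2, h3]

/-- **LoopSurj holds for every domain** (injectivity + image + the count). [cite: KhristoforovSmirnov2021, §1.2 (loop configurations, pp. 3–4)] -/
theorem loopSurj_holds : LoopSurj D := by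
  classical
  intro r c ξ hξ
  -- the image of the colourings of `G`
  set I := (D.verts.powerset).image (fun S : Finset (Site 2) => xiOf D (↑S : Set (Site 2)) r c) with hI
  have hIsub : I ⊆ loopSpace D r := by
    intro ζ hζ
    obtain ⟨S, -, rfl⟩ := Finset.mem_image.1 hζ
    exact loopImage_holds D _ r c
  have hIcard : #I = 2 ^ #D.verts := by
    rw [hI, Finset.card_image_of_injOn, Finset.card_powerset]
    intro S hS S' hS' h
    have hS1 := Finset.mem_powerset.1 (Finset.mem_coe.1 hS)
    have hS2 := Finset.mem_powerset.1 (Finset.mem_coe.1 hS')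
    ext u
    constructor
    · intro hu
      exact Finset.mem_coe.1 (((loopInj_holds D _ _ r c h) u (hS1 hu)).1 (Finset.mem_coe.2 hu))
    · intro hu
      exact Finset.mem_coe.1 (((loopInj_holds D _ _ r c h) u (hS2 hu)).2 (Finset.mem_coe.2 hu))
  have hIeq : I = loopSpace D r :=
    Finset.eq_of_subset_of_card_le hIsub (by rw [hIcard, loopCount_holds D r])
  rw [← hIeq] at hξ
  obtain ⟨S, -, rfl⟩ := Finset.mem_image.1 hξ
  exact ⟨_, rfl⟩


/-! #### Any EVEN boundary is attained: the image of the incidence matrix is the hyperplane `Σ_F t(F) = 0`,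
so every parity pattern with an even number of odd faces has exactly `2 ^ #G` solutions (the counting backbone
for the six-odd-point spaces of the five-point normalisation). -/

/-- every column of the incidence matrix has exactly two `1`s: the boundary of any edge vector has even total mass. [cite: KhristoforovSmirnov2021, §1.2 (loop configurations, pp. 3–4)] -/
theorem sum_incMat_mulVec (g : ↥(hBonds D) → ZMod 2) : ∑ F, (incMat D).mulVec g F = 0 := by
  classical
  have hcomm : ∑ F, (incMat D).mulVec g F = ∑ b, g b * ∑ F, (incMat D) F b := by
    simp only [Matrix.mulVec, dotProduct]
    rw [Finset.sum_comm]
    refine Finset.sum_congr rfl fun b _ => ?_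
    rw [Finset.mul_sum]
    refine Finset.sum_congr rfl fun F _ => ?_
    ring
  rw [hcomm]
  refine Finset.sum_eq_zero fun b _ => ?_
  have hcol : ∑ F, (incMat D) F b = (incMat D).transpose.mulVec (fun _ => (1 : ZMod 2)) b := by
    simp only [Matrix.mulVec, dotProduct, Matrix.transpose_apply, mul_one]
  rw [hcol, transpose_mulVec_const_one, Pi.zero_apply, mul_zero]

/-- **the range of the boundary map is the even hyperplane** `{t | Σ_F t F = 0}` (cokernel = constants + dimension count). [cite: KhristoforovSmirnov2021, §1.2 (loop configurations, pp. 3–4)] -/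
theorem mem_range_incMat_iff (t : ↥(triFacesTouching D.verts) → ZMod 2) :
    t ∈ LinearMap.range (incMat D).mulVecLin ↔ ∑ F, t F = 0 := by
  classical
  -- the sum functional
  let s : (↥(triFacesTouching D.verts) → ZMod 2) →ₗ[ZMod 2] ZMod 2 :=
    { toFun := fun t => ∑ F, t F
      map_add' := fun a b => by simp only [Pi.add_apply, Finset.sum_add_distrib]
      map_smul' := fun c a => by simp only [Pi.smul_apply, smul_eq_mul, RingHom.id_apply, Finset.mul_sum] }
  have hle : LinearMap.range (incMat D).mulVecLin ≤ LinearMap.ker s := by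
    rintro t ⟨g, rfl⟩
    rw [LinearMap.mem_ker]
    exact sum_incMat_mulVec D g
  -- dimensions: range has finrank #T − 1, ker s has finrank #T − 1 (s is onto `ZMod 2`)
  obtain ⟨F₀, hF₀⟩ := touching_nonempty D
  have hs_apply : ∀ u : ↥(triFacesTouching D.verts) → ZMod 2, s u = ∑ F, u F := fun u => rfl
  have hs_surj : Function.Surjective s := by
    intro a
    refine ⟨fun F => if F = ⟨F₀, hF₀⟩ then a else 0, ?_⟩
    rw [hs_apply]
    simp only [Finset.sum_ite_eq', Finset.mem_univ, if_true]
  have hker : Module.finrank (ZMod 2) ↥(LinearMap.ker s) + 1 = #(triFacesTouching D.verts) := by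
    have h := LinearMap.finrank_range_add_finrank_ker s
    rw [LinearMap.range_eq_top.2 hs_surj, finrank_top, Module.finrank_self, Module.finrank_fintype_fun_eq_card,
      Fintype.card_coe] at h
    omega
  have hrange : Module.finrank (ZMod 2) ↥(LinearMap.range (incMat D).mulVecLin) + 1 = #(triFacesTouching D.verts) :=
    rank_incMat_add_one D
  have heq : LinearMap.range (incMat D).mulVecLin = LinearMap.ker s :=
    Submodule.eq_of_le_of_finrank_eq hle (by omega)
  rw [heq, LinearMap.mem_ker]
  rfl

/-- **every even parity pattern has exactly `2 ^ #G` edge vectors with that boundary.** [cite: KhristoforovSmirnov2021, §1.2 (loop configurations, pp. 3–4)] -/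
theorem card_filter_mulVec_eq {t : ↥(triFacesTouching D.verts) → ZMod 2} (ht : ∑ F, t F = 0) :
    #(Finset.univ.filter fun g : ↥(hBonds D) → ZMod 2 => (incMat D).mulVec g = t) = 2 ^ #D.verts := by
  classical
  obtain ⟨g₀, hg₀⟩ := (mem_range_incMat_iff D t).2 ht
  rw [Matrix.mulVecLin_apply] at hg₀
  have hself : ∀ g : ↥(hBonds D) → ZMod 2, g + g = 0 := by
    intro g; funext b; exact (zmod2_add_eq_zero_iff _ _).2 rfl
  have h2 : #(Finset.univ.filter fun g : ↥(hBonds D) → ZMod 2 => (incMat D).mulVec g = t) =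
      #(Finset.univ.filter fun g : ↥(hBonds D) → ZMod 2 => (incMat D).mulVec g = 0) := by
    refine Finset.card_bij (fun g _ => g + g₀) (fun g hg => ?_) (fun g _ g' _ h => add_right_cancel h) (fun h hh => ?_)
    · refine Finset.mem_filter.2 ⟨Finset.mem_univ _, ?_⟩
      rw [Matrix.mulVec_add, (Finset.mem_filter.1 hg).2, hg₀]
      funext F; exact (zmod2_add_eq_zero_iff _ _).2 rfl
    · refine ⟨h + g₀, Finset.mem_filter.2 ⟨Finset.mem_univ _, ?_⟩, ?_⟩
      · rw [Matrix.mulVec_add, (Finset.mem_filter.1 hh).2, hg₀, zero_add]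
      · rw [add_assoc, hself, add_zero]
  rw [h2, ← card_ker_incMat D, Nat.card_eq_fintype_card, Fintype.card_subtype]
  congr 1
  ext g
  simp only [Finset.mem_filter, Finset.mem_univ, true_and, LinearMap.mem_ker, Matrix.mulVecLin_apply]

/-- **the number of edge sets of `H_G` with a prescribed EVEN set of odd faces is `2 ^ #G`** (e.g. the five corner faces
plus one interior face — the six-odd-point space of the five-point normalisation). [cite: KhristoforovSmirnov2021, §1.2 (loop configurations, pp. 3–4)] -/
theorem card_filter_parity_eq {O : Finset HexVertex} (hO : O ⊆ triFacesTouching D.verts) (heven : Even #O) :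
    #((hBonds D).powerset.filter fun ξ => ∀ F ∈ triFacesTouching D.verts, (Odd (xiDeg ξ F) ↔ F ∈ O)) = 2 ^ #D.verts := by
  classical
  set t : ↥(triFacesTouching D.verts) → ZMod 2 := fun F => if F.1 ∈ O then 1 else 0 with ht
  have hsum : ∑ F, t F = 0 := by
    rw [ht]
    simp only
    rw [Finset.sum_boole]
    have hc : #(Finset.univ.filter fun F : ↥(triFacesTouching D.verts) => F.1 ∈ O) = #O := by
      rw [← Finset.card_map ⟨Subtype.val, Subtype.val_injective⟩]
      congr 1
      ext F
      simp only [Finset.mem_map, Finset.mem_filter, Finset.mem_univ, true_and, Function.Embedding.coeFn_mk]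
      constructor
      · rintro ⟨F', hF', rfl⟩; exact hF'
      · intro hF; exact ⟨⟨F, hO hF⟩, hF, rfl⟩
    rw [hc]
    exact (ZMod.natCast_eq_zero_iff_even).2 heven
  rw [← card_filter_mulVec_eq D hsum]
  refine Finset.card_bij (fun ξ _ => indic D ξ) (fun ξ hξ => ?_) (fun ξ hξ ξ' hξ' h => ?_) (fun g hg => ?_)
  · obtain ⟨hξB, hpar⟩ := Finset.mem_filter.1 hξ
    have hξB' := Finset.mem_powerset.1 hξB
    refine Finset.mem_filter.2 ⟨Finset.mem_univ _, ?_⟩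
    funext F
    rw [incMat_mulVec_indic D hξB' F, ht]
    exact (natCast_eq_ite_iff _ _).2 (hpar F.1 F.2)
  · exact indic_injective D (Finset.mem_powerset.1 (Finset.mem_filter.1 hξ).1)
      (Finset.mem_powerset.1 (Finset.mem_filter.1 hξ').1) h
  · obtain ⟨ξ, hξB, rfl⟩ := exists_indic_eq D g
    refine ⟨ξ, Finset.mem_filter.2 ⟨Finset.mem_powerset.2 hξB, fun F hF => ?_⟩, rfl⟩
    have := congrFun (Finset.mem_filter.1 hg).2 ⟨F, hF⟩
    rw [incMat_mulVec_indic D hξB ⟨F, hF⟩, ht] at this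
    exact (natCast_eq_ite_iff _ _).1 this

end LoopCount


/-! ### KhSLemma2Face: Khristoforov–Smirnov's Lemma 2 as printed (the crossing probability is a ratio of counts) -/


/-- the loop configuration only reads `σ ∩ G`. [cite: KhristoforovSmirnov2021, §1.2 (colourings ↔ loop configurations, pp. 3–4)] -/
theorem xiOf_inter (σ : SiteConfig (Site 2)) (r : Fin 5) (c : Bool) :
    xiOf D (σ ∩ ↑D.verts) r c = xiOf D σ r c := by
  classical
  unfold xiOf
  refine Finset.filter_congr fun e _ => ?_
  simp only [bicol_inter_iff]

/-- linking inside `ξ_{r,c}(σ)` is `IStep`-reachability. [cite: KhristoforovSmirnov2021, §1.2 (colourings ↔ loop configurations, pp. 3–4)] -/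
theorem xiLinked_xiOf_iff (σ : SiteConfig (Site 2)) (r : Fin 5) (c : Bool) (Y Y' : HexVertex) :
    XiLinked (xiOf D σ r c) Y Y' ↔ Relation.ReflTransGen (IStep D σ r c) Y Y' := by
  unfold XiLinked
  have key : (fun F F' : HexVertex => ∃ j : Fin 3, F' = oppFace F j ∧
      s(faceVertex F (j + 1), faceVertex F (j + 2)) ∈ xiOf D σ r c) = IStep D σ r c := by
    funext F F'
    apply propext
    rw [iStep_iff]
    refine exists_congr fun j => and_congr_right fun _ => ?_
    exact mem_xiOf_iff D σ r c F j
  rw [key]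

/-- pattern B of `ξ_{r,c}(σ)` is the matching B of `σ`. [cite: KhristoforovSmirnov2021, §1.2 (colourings ↔ loop configurations, pp. 3–4)] -/
theorem xiPatternB_xiOf_iff (σ : SiteConfig (Site 2)) (r : Fin 5) (c : Bool) :
    XiPatternB D r (xiOf D σ r c) ↔ MatchB D σ r c := by
  unfold XiPatternB MatchB
  simp only [xiLinked_xiOf_iff]

/-- **KhSLemma2Face holds for every domain**: `P_{1/2}[A_{r+1} ↔ A_{r+3} open] = #{ξ ∈ W_Ω : pattern B} / #W_Ω`
(KhS21 Lemma 2, `x = n = 1`, per reference corner of a five-marked domain). [cite: KhristoforovSmirnov2021, §1.2 Lemma 2 (p. 4)] -/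
theorem khsLemma2Face_holds : KhSLemma2Face D := by
  classical
  intro r
  rw [TriMarkedDomain.openCrossingProb_eq_card_div D, loopCount_holds D r]
  push_cast
  congr 1
  -- `#{T ⊆ G | open crossing} = #{ξ ∈ W_Ω | pattern B}` via `T ↦ ξ_{r,false}(T)`
  norm_cast
  refine Finset.card_bij (fun T _ => xiOf D (↑T : Set (Site 2)) r false) (fun T hT => ?_) (fun T hT T' hT' h => ?_)
    (fun ξ hξ => ?_)
  · obtain ⟨hTG, hopen⟩ := Finset.mem_filter.1 hT
    refine Finset.mem_filter.2 ⟨loopImage_holds D _ r false, ?_⟩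
    rw [xiPatternB_xiOf_iff]
    exact ((fiveMarkedLoopLemma_holds D ↑T r).2.1).2 hopen
  · have hTG := Finset.mem_powerset.1 (Finset.mem_filter.1 hT).1
    have hTG' := Finset.mem_powerset.1 (Finset.mem_filter.1 hT').1
    have hag := loopInj_holds D _ _ r false h
    ext u
    constructor
    · intro hu; exact Finset.mem_coe.1 ((hag u (hTG hu)).1 (Finset.mem_coe.2 hu))
    · intro hu; exact Finset.mem_coe.1 ((hag u (hTG' hu)).2 (Finset.mem_coe.2 hu))
  · obtain ⟨hξ, hB⟩ := Finset.mem_filter.1 hξ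
    obtain ⟨σ, hσ⟩ := loopSurj_holds D r false ξ hξ
    refine ⟨D.verts.filter (fun v => v ∈ σ), Finset.mem_filter.2 ⟨Finset.mem_powerset.2 (Finset.filter_subset _ _), ?_⟩, ?_⟩
    · have hS : (↑(D.verts.filter fun v => v ∈ σ) : Set (Site 2)) = σ ∩ ↑D.verts := by
        ext v; simp [and_comm]
      rw [hS, ← (fiveMarkedLoopLemma_holds D _ r).2.1, ← (loopLocal_holds D σ r false).2, ← xiPatternB_xiOf_iff, hσ]
      exact hB
    · have hS : (↑(D.verts.filter fun v => v ∈ σ) : Set (Site 2)) = σ ∩ ↑D.verts := by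
        ext v; simp [and_comm]
      rw [hS, xiOf_inter, hσ]

end Literature.Probability.Percolation.FivePoint

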